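import Summits.Ventures.PercRepro.C026GluingCount
import Summits.Ventures.PercRepro.C026HubPairGadget

/-!
# Hub-pair graphs, VII: the class and the D-free inequality on it (p5, gen 11)

mine-3's **hub-pair multigraphs** (§25.1, statement sheet §25.9): every non-mark vertex has at most
one non-mark neighbour other than itself (its partner; parallel copies, mark edges of any
multiplicity, mark–mark edges and loops anywhere allowed).  **`dFreeIneq_of_hubPair`**: the D-free inequality
`(★)` holds on every hub-pair multigraph with three distinct marks — by strong induction on the
number of edges through the composition theorem `dFreeIneq_of_gluing` (mine-3 §26.8, p6): the edges at
a non-mark `x` and at its partner `y` form one side of a 3-terminal gluing, that side is a pair gadget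
(`dFreeIneq_of_supported5`, or a single hub `…4`) and the other side is a smaller hub-pair graph; a
graph without edges at non-marks is supported on the marks (`dFreeIneq_of_supported3`).
-/

namespace PercRepro

namespace PairModel

/-- The class bit of `(i, j)` on the three marks: classes `(0,1), (0,2), (1,2)` are the bits `0, 1, 2`. -/
def bitOfClass3 (k i j : ℕ) : Bool :=
  match i, j with
  | 0, 1 => k.testBit 0 | 1, 0 => k.testBit 0
  | 0, 2 => k.testBit 1 | 2, 0 => k.testBit 1
  | 1, 2 => k.testBit 2 | 2, 1 => k.testBit 2
  | _, _ => false

/-- The rows on the three marks with the class bits of `k`. -/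
def markRows (k : ℕ) : Rows := (List.range 3).map fun i => maskOf 3 (bitOfClass3 k i)

/-- The class bits of rows on three vertices. -/
def enc3 (R : Rows) : ℕ := maskOf 3 fun t => [adj R 0 1, adj R 0 2, adj R 1 2].getD t false

set_option maxRecDepth 100000 in
/-- **The marks alone: every state passes the check** (there is no `KL` source). -/
theorem chk3_all : ∀ o < 8, ∀ c < 8, chk 3 (markRows o) (markRows c) = true := by decide +kernel

/-- **Rows on three vertices are `markRows` of their class bits.** -/
theorem rows_eq_markRows (R : Rows) (hR : R = (List.range 3).map fun i => maskOf 3 fun j => adj R i j)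
    (hdiag : ∀ i, adj R i i = false) (hsymm : ∀ i < 3, ∀ j < 3, adj R i j = adj R j i) :
    R = markRows (enc3 R) := by
  rw [hR]
  unfold markRows
  refine List.map_congr_left fun i hi => maskOf_congr fun j hj => ?_
  rw [List.mem_range] at hi
  have key : ∀ i < 3, ∀ j < 3, adj R i j = bitOfClass3 (enc3 R) i j := by
    intro i hi j hj
    interval_cases i <;> interval_cases j <;>
      first
      | exact hdiag _
      | (simp only [bitOfClass3, enc3, testBit_maskOf]; simp; exact hsymm _ (by omega) _ (by omega))
      | (simp only [bitOfClass3, enc3, testBit_maskOf]; simp)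
  rw [← hR]
  exact key i hi j hj

end PairModel

namespace MultiGraph

open PairModel

variable {V E : Type*} {G : MultiGraph V E}

/-- **The marks alone**: the D-free inequality on a graph supported on the three marks. -/
theorem dFreeIneq_of_supported3 [Fintype E] [DecidableEq E] {ι : ℕ → V} (hsup : G.Supported ι 3)
    (hinj : InjBelow ι 3) : G.DFreeIneq (ι 0) (ι 1) (ι 2) := by
  refine dFreeIneq_of_chk hsup hinj (by norm_num) fun ω _ => ?_
  have hO : G.oRows ι 3 ω = markRows (enc3 (G.oRows ι 3 ω)) :=
    rows_eq_markRows _ (oRows_eq_map ω) (adj_oRows_self ω) (fun i hi j hj => adj_oRows_symm ω hi hj)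
  have hC : G.cRows ι 3 ω = markRows (enc3 (G.cRows ι 3 ω)) :=
    rows_eq_markRows _ (cRows_eq_map ω) (adj_cRows_self ω) (fun i hi j hj => adj_cRows_symm ω hi hj)
  have ho : enc3 (G.oRows ι 3 ω) < 8 := maskOf_lt 3 _
  have hc : enc3 (G.cRows ι 3 ω) < 8 := maskOf_lt 3 _
  have h := chk3_all _ ho _ hc
  rw [← hO, ← hC] at h
  exact h

/-! ### The class -/

variable (G)

/-- **mine-3's hub-pair multigraphs**: every non-mark vertex has at most one non-mark neighbour
other than itself (loops do not count). -/
def IsHubPairGraph (a b c : V) : Prop :=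
  ∀ v, v ≠ a → v ≠ b → v ≠ c → ∀ e e' w w', G.Joins e v w → G.Joins e' v w' → w ≠ v → w' ≠ v →
    (w ≠ a ∧ w ≠ b ∧ w ≠ c) → (w' ≠ a ∧ w' ≠ b ∧ w' ≠ c) → w = w'

variable {G}

/-- An edge at `u` and at `v ≠ u` joins them. -/
theorem joins_of_edgeAt {e : E} {u v : V} (hu : G.EdgeAt e u) (hv : G.EdgeAt e v) (huv : u ≠ v) :
    G.Joins e u v := by
  rcases hu with hu | hu <;> rcases hv with hv | hv
  · exact absurd (hu.symm.trans hv) huv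
  · exact Or.inl ⟨hu, hv⟩
  · exact Or.inr ⟨hv, hu⟩
  · exact absurd (hu.symm.trans hv) huv

/-- The part of a gluing of a hub-pair graph is a hub-pair graph. -/
theorem IsHubPairGraph.part {a b c : V} (hG : G.IsHubPairGraph a b c) (side : E → Bool) (s : Bool) :
    (G.part side s).IsHubPairGraph a b c := by
  intro v hva hvb hvc e e' w w' he he' hwv hw'v hw hw'
  exact hG v hva hvb hvc e.1 e'.1 w w' he he' hwv hw'v hw hw'

/-! ### The split at a non-mark and its partner -/

section Split

variable {a b c x y : V} (hG : G.IsHubPairGraph a b c)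
  (hx : x ≠ a ∧ x ≠ b ∧ x ≠ c) (hy : y ≠ a ∧ y ≠ b ∧ y ≠ c)
  (hxy : ∀ e w, G.Joins e x w → w ≠ x → (w ≠ a ∧ w ≠ b ∧ w ≠ c) → w = y)
  (hyx : ∀ e w, G.Joins e y w → w ≠ y → (w ≠ a ∧ w ≠ b ∧ w ≠ c) → w = x)

open Classical in
/-- The side of the split: the edges at `x` or at `y`. -/
noncomputable def splitSide (G : MultiGraph V E) (x y : V) (e : E) : Bool :=
  decide (G.EdgeAt e x ∨ G.EdgeAt e y)

/-- Membership in the split side. -/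
theorem splitSide_eq_true_iff (e : E) : G.splitSide x y e = true ↔ G.EdgeAt e x ∨ G.EdgeAt e y := by
  classical
  simp [splitSide]

include hx hy hxy hyx in
/-- **The split is a 3-terminal gluing**: a non-mark other than `x, y` carries no edge at `x` or `y`. -/
theorem isGluing_splitSide : G.IsGluing a b c (G.splitSide x y) := by
  intro v hva hvb hvc e e' he he'
  by_cases hv : v = x ∨ v = y
  · have h1 : G.splitSide x y e = true := by
      rw [splitSide_eq_true_iff]
      rcases hv with rfl | rfl
      · exact Or.inl he
      · exact Or.inr he
    have h2 : G.splitSide x y e' = true := by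
      rw [splitSide_eq_true_iff]
      rcases hv with rfl | rfl
      · exact Or.inl he'
      · exact Or.inr he'
    rw [h1, h2]
  · have hvx : v ≠ x := fun h => hv (Or.inl h)
    have hvy : v ≠ y := fun h => hv (Or.inr h)
    have key : ∀ f, G.EdgeAt f v → G.splitSide x y f = false := by
      intro f hf
      cases h : G.splitSide x y f
      · rfl
      · exfalso
        rw [splitSide_eq_true_iff] at h
        rcases h with h | h
        · exact hvy (hxy f v (joins_of_edgeAt h hf hvx.symm) hvx ⟨hva, hvb, hvc⟩)
        · exact hvx (hyx f v (joins_of_edgeAt h hf hvy.symm) hvy ⟨hva, hvb, hvc⟩)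
    rw [key e he, key e' he']

/-- The five supported vertices of the pair side. -/
def pairIota (a b c x y : V) (i : ℕ) : V :=
  if i = 0 then a else if i = 1 then b else if i = 2 then c else if i = 3 then x else y

include hx hy hxy hyx in
/-- **The pair side is supported on `a, b, c, x, y`**, every edge at `x` or `y`. -/
theorem supported_part_splitSide :
    (G.part (G.splitSide x y) true).Supported (pairIota a b c x y) 5 ∧
      ∀ e : {e // G.splitSide x y e = true}, ∃ k, 3 ≤ k ∧ k < 5 ∧
        ((G.part (G.splitSide x y) true).fst e = pairIota a b c x y k ∨
          (G.part (G.splitSide x y) true).snd e = pairIota a b c x y k) := by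
  have hmem : ∀ e : {e // G.splitSide x y e = true}, ∀ w, G.EdgeAt e.1 w →
      ∃ i < 5, w = pairIota a b c x y i := by
    intro e w hw
    by_cases hwm : w = a ∨ w = b ∨ w = c
    · rcases hwm with rfl | rfl | rfl
      · exact ⟨0, by norm_num, rfl⟩
      · exact ⟨1, by norm_num, rfl⟩
      · exact ⟨2, by norm_num, rfl⟩
    · have hw' : w ≠ a ∧ w ≠ b ∧ w ≠ c := by
        refine ⟨fun h => hwm (Or.inl h), fun h => hwm (Or.inr (Or.inl h)),
          fun h => hwm (Or.inr (Or.inr h))⟩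
      have hs := (splitSide_eq_true_iff e.1).1 e.2
      rcases hs with hs | hs
      · by_cases hwx : w = x
        · exact ⟨3, by norm_num, by simp [pairIota, hwx]⟩
        · have := hxy e.1 w (joins_of_edgeAt hs hw (Ne.symm hwx)) hwx hw'
          exact ⟨4, by norm_num, by simp [pairIota, this]⟩
      · by_cases hwy : w = y
        · exact ⟨4, by norm_num, by simp [pairIota, hwy]⟩
        · have := hyx e.1 w (joins_of_edgeAt hs hw (Ne.symm hwy)) hwy hw'
          exact ⟨3, by norm_num, by simp [pairIota, this]⟩
  refine ⟨fun e => ⟨hmem e _ (Or.inl rfl), hmem e _ (Or.inr rfl)⟩, fun e => ?_⟩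
  have hs := (splitSide_eq_true_iff e.1).1 e.2
  have h3 : pairIota a b c x y 3 = x := by simp [pairIota]
  have h4 : pairIota a b c x y 4 = y := by simp [pairIota]
  rcases hs with hs | hs
  · refine ⟨3, by norm_num, by norm_num, ?_⟩
    rw [part_fst, part_snd, h3]
    exact hs
  · refine ⟨4, by norm_num, by norm_num, ?_⟩
    rw [part_fst, part_snd, h4]
    exact hs

/-- `pairIota` is injective below `5` when the five vertices are distinct. -/
theorem injBelow_pairIota (hab : a ≠ b) (hac : a ≠ c) (hbc : b ≠ c) (hx : x ≠ a ∧ x ≠ b ∧ x ≠ c)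
    (hy : y ≠ a ∧ y ≠ b ∧ y ≠ c) (hxy : x ≠ y) : InjBelow (pairIota a b c x y) 5 := by
  intro i hi j hj h
  interval_cases i <;> interval_cases j <;> simp [pairIota] at h ⊢ <;>
    first
    | rfl
    | exact absurd h hab | exact absurd h hac | exact absurd h hbc
    | exact absurd h hab.symm | exact absurd h hac.symm | exact absurd h hbc.symm
    | exact absurd h hx.1 | exact absurd h hx.2.1 | exact absurd h hx.2.2
    | exact absurd h hx.1.symm | exact absurd h hx.2.1.symm | exact absurd h hx.2.2.symm
    | exact absurd h hy.1 | exact absurd h hy.2.1 | exact absurd h hy.2.2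
    | exact absurd h hy.1.symm | exact absurd h hy.2.1.symm | exact absurd h hy.2.2.symm
    | exact absurd h hxy | exact absurd h hxy.symm

/-- `pairIota` is injective below `4` when `a, b, c, x` are distinct (`y` unused). -/
theorem injBelow_pairIota4 (hab : a ≠ b) (hac : a ≠ c) (hbc : b ≠ c)
    (hx : x ≠ a ∧ x ≠ b ∧ x ≠ c) : InjBelow (pairIota a b c x y) 4 := by
  intro i hi j hj h
  interval_cases i <;> interval_cases j <;> simp [pairIota] at h ⊢ <;>
    first
    | rfl
    | exact absurd h hab | exact absurd h hac | exact absurd h hbc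
    | exact absurd h hab.symm | exact absurd h hac.symm | exact absurd h hbc.symm
    | exact absurd h hx.1 | exact absurd h hx.2.1 | exact absurd h hx.2.2
    | exact absurd h hx.1.symm | exact absurd h hx.2.1.symm | exact absurd h hx.2.2.symm

end Split

end MultiGraph

end PercRepro
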